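import Mathlib.Analysis.SpecialFunctions.Pow.Real
import Literature.NumberTheory.DiophantineGeometry.PartitionTableauxProofs
import Literature.NumberTheory.DiophantineGeometry.SchurWeylPlethysmHwMultiplicityProofs

/-!
# `GradedDesignFamily`, line `schur-weyl-colour-cells`: stub `stub_twoRowDegrees`
# (the two-row degrees are the ballot numbers)

Crux `stmt-MatrixMultiplication-7610`
(`Summit.MatrixMultiplication.MatrixMultiplication.Theses.LevelGradedCohnUmans.GradedDesignFamily`),
line `schur-weyl-colour-cells`, registered stub B1 `stub_twoRowDegrees`: for every `n : ℕ` and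
every real `s`,
`∑_{μ ⊢ n, #parts μ ≤ 2} (f^μ) ^ s ≤ ∑_{j ≤ n/2} (C(n,j) (n - 2j + 1) / (n - j + 1)) ^ s`,
where `f^μ = numStandardTableaux μ` is the number of standard Young tableaux of shape `μ` and
`C(n,j) (n - 2j + 1) / (n - j + 1) = C(n,j) - C(n,j-1)` is the ballot number.

## Proof

* A partition `μ ⊢ n` with at most two parts has sorted parts `[]` (`n = 0`), `[n]`, or
  `[n - j, j]` with `1 ≤ j ≤ n/2`; it is determined by its second zero-padded row
  `j(μ) = μ.sortedParts.getD 1 0 ∈ [0, n/2]`, and its first row is `n - j(μ)`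
  (`trd_sortedParts_eq`, `trd_injOn`).
* The Frobenius–Young degree formula with two rows (the tree's
  `card_stdFilling_mul_prod_factorial`, Frame–Robinson–Thrall (2.2), with `N = 2` and
  `β`-numbers `(n - j + 1, j)`) reads `f^μ · (n - j + 1)! · j! = n! · (n - 2j + 1)`
  (`trd_numStandardTableaux_mul_factorial`), whence
  `f^μ · (n - j + 1) = C(n,j) · (n - 2j + 1)` (`trd_numStandardTableaux_mul`) and
  `f^μ = C(n,j) (n - 2j + 1) / (n - j + 1)` in `ℝ` (`trd_numStandardTableaux_eq`).
* Reindex the left-hand sum by `j(μ)` (`Finset.sum_image`); the image lies in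
  `range (n/2 + 1)` and the unused terms are `≥ 0` (`Real.rpow_nonneg`, the ballot numbers
  being `≥ 0` for `2j ≤ n`), so the sum only grows (`Finset.sum_le_sum_of_subset_of_nonneg`).

The row-length bridge `λ_i = μ.sortedParts.getD i 0` is the tree's `rowLen_youngDiagram` and the
row bound is `fst_lt_of_mem_youngDiagram` (`SchurWeylPlethysmHwMultiplicityProofs.lean`).
-/

set_option linter.dupNamespace false

noncomputable section

open scoped BigOperators
open Literature.NumberTheory.DiophantineGeometry

namespace Summit.MatrixMultiplication.MatrixMultiplication.Theorems.GradedDesignFamily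

/-! ## Partitions with at most two parts -/

/-- A partition `μ ⊢ n` with at most two parts, with second zero-padded row
`j = μ.sortedParts.getD 1 0`, has `2j ≤ n`, first row `n - j`, and sorted parts `[]`
(if `n = 0`), `[n]` (if `j = 0 < n`) or `[n - j, j]` (if `0 < j`). -/
theorem trd_sortedParts_eq {n : ℕ} (μ : Nat.Partition n) (hμ : Multiset.card μ.parts ≤ 2) :
    2 * μ.sortedParts.getD 1 0 ≤ n ∧
      μ.sortedParts.getD 0 0 = n - μ.sortedParts.getD 1 0 ∧
        μ.sortedParts =
          if n = 0 then [] else if μ.sortedParts.getD 1 0 = 0 then [n]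
            else [n - μ.sortedParts.getD 1 0, μ.sortedParts.getD 1 0] := by
  have hlen : μ.sortedParts.length ≤ 2 := by rwa [Nat.Partition.length_sortedParts]
  have hsum : μ.sortedParts.sum = n := μ.sum_sortedParts
  have hsort : μ.sortedParts.Pairwise (· ≥ ·) := μ.sortedGE_sortedParts.pairwise
  have hpos : ∀ a ∈ μ.sortedParts, 0 < a := fun a h => μ.pos_of_mem_sortedParts h
  revert hlen hsum hsort hpos
  generalize μ.sortedParts = l
  rintro hlen hsum hsort hpos
  rcases l with _ | ⟨a, _ | ⟨b, _ | ⟨c, t⟩⟩⟩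
  · rw [List.sum_nil] at hsum
    subst hsum
    simp
  · rw [List.sum_cons, List.sum_nil, add_zero] at hsum
    subst hsum
    have ha : a ≠ 0 := (hpos a (by simp)).ne'
    simp [ha]
  · rw [List.sum_cons, List.sum_cons, List.sum_nil, add_zero] at hsum
    have hb : b ≠ 0 := (hpos b (by simp)).ne'
    have hab : b ≤ a := (List.pairwise_cons.1 hsort).1 b (by simp)
    have hn : n ≠ 0 := by omega
    have e0 : [a, b].getD 0 0 = a := rfl
    have e1 : [a, b].getD 1 0 = b := rfl
    rw [e0, e1, if_neg hn, if_neg hb, show n - b = a by omega]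
    exact ⟨by omega, rfl, rfl⟩
  · simp only [List.length_cons] at hlen
    omega

/-- On the partitions of `n` with at most two parts, the second row `μ ↦ μ.sortedParts.getD 1 0`
is injective (the sorted parts, hence the parts, are determined by it). -/
theorem trd_injOn (n : ℕ) :
    Set.InjOn (fun μ : Nat.Partition n => μ.sortedParts.getD 1 0)
      ↑(Finset.univ.filter fun μ : Nat.Partition n => Multiset.card μ.parts ≤ 2) := by
  intro μ hμ ν hν h
  rw [Finset.coe_filter] at hμ hν
  simp only [Finset.mem_univ, true_and, Set.mem_setOf_eq] at hμ hν h
  have hl : μ.sortedParts = ν.sortedParts := by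
    rw [(trd_sortedParts_eq μ hμ).2.2, h]
    exact (trd_sortedParts_eq ν hν).2.2.symm
  have key : ∀ ρ : Nat.Partition n, ((ρ.sortedParts : List ℕ) : Multiset ℕ) = ρ.parts :=
    fun ρ => Multiset.sort_eq _ _
  exact Nat.Partition.ext (by rw [← key μ, ← key ν, hl])

/-! ## The two-row degrees -/

/-- **Frobenius–Young with two rows** (Frame–Robinson–Thrall 1954, (2.2), `N = 2`): if the
Young diagram of `μ ⊢ n` has rows `a = λ₀`, `j = λ₁` and no further rows, then
`f^μ · (a + 1)! · j! = n! · (a + 1 - j)` (the `β`-numbers are `a + 1 > j`). -/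
theorem trd_numStandardTableaux_mul_factorial {n : ℕ} (μ : Nat.Partition n) {a j : ℕ}
    (h0 : μ.youngDiagram.rowLen 0 = a) (h1 : μ.youngDiagram.rowLen 1 = j)
    (hN : ∀ c ∈ μ.youngDiagram.cells, c.1 < 2) (hja : j ≤ a + 1) :
    numStandardTableaux μ * (a + 1).factorial * j.factorial = n.factorial * (a + 1 - j) := by
  have key := card_stdFilling_mul_prod_factorial 2 n μ.youngDiagram
    μ.card_cells_youngDiagram hN
  rw [← numStandardTableaux_eq_card_stdFilling] at key
  have hI0 : Finset.Ioo 0 2 = {1} := by decide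
  have hI1 : Finset.Ioo 1 2 = ∅ := by decide
  simp only [Finset.prod_range_succ, Finset.prod_range_zero, one_mul, hI0, hI1,
    Finset.prod_singleton, Finset.prod_empty, mul_one, h0, h1, Nat.reduceSub, add_zero] at key
  rw [← Nat.cast_sub hja] at key
  rw [mul_assoc]
  exact_mod_cast key

/-- **The two-row degrees are ballot numbers** (division-free form): for `μ ⊢ n` with at most
two parts and second row `j = μ.sortedParts.getD 1 0`,
`f^μ · (n - j + 1) = C(n, j) · (n - 2j + 1)`. -/
theorem trd_numStandardTableaux_mul {n : ℕ} (μ : Nat.Partition n)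
    (hμ : Multiset.card μ.parts ≤ 2) :
    numStandardTableaux μ * (n - μ.sortedParts.getD 1 0 + 1) =
      n.choose (μ.sortedParts.getD 1 0) * (n - 2 * μ.sortedParts.getD 1 0 + 1) := by
  obtain ⟨h2j, hget0, -⟩ := trd_sortedParts_eq μ hμ
  obtain ⟨j, hj⟩ : ∃ j, μ.sortedParts.getD 1 0 = j := ⟨_, rfl⟩
  rw [hj] at h2j hget0 ⊢
  have h0 : μ.youngDiagram.rowLen 0 = n - j := (rowLen_youngDiagram μ 0).trans hget0
  have h1 : μ.youngDiagram.rowLen 1 = j := (rowLen_youngDiagram μ 1).trans hj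
  have hN : ∀ c ∈ μ.youngDiagram.cells, c.1 < 2 := fun c hc =>
    fst_lt_of_mem_youngDiagram μ hμ hc
  have e1 := trd_numStandardTableaux_mul_factorial μ h0 h1 hN (by omega)
  obtain ⟨m, hm⟩ : ∃ m, n - j = m + j := ⟨n - j - j, by omega⟩
  have e2 : n.choose j * j.factorial * (m + j).factorial = n.factorial := by
    rw [← hm]
    exact Nat.choose_mul_factorial_mul_factorial (by omega)
  rw [hm, show m + j + 1 - j = m + 1 by omega] at e1
  rw [hm, show n - 2 * j + 1 = m + 1 by omega]
  refine Nat.eq_of_mul_eq_mul_right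
    (Nat.mul_pos (Nat.factorial_pos (m + j)) (Nat.factorial_pos j)) ?_
  calc numStandardTableaux μ * (m + j + 1) * ((m + j).factorial * j.factorial)
      = numStandardTableaux μ * (m + j + 1).factorial * j.factorial := by
        rw [Nat.factorial_succ]; ring
    _ = n.factorial * (m + 1) := e1
    _ = n.choose j * (m + 1) * ((m + j).factorial * j.factorial) := by rw [← e2]; ring

/-- **The two-row degrees are ballot numbers**: for `μ ⊢ n` with at most two parts and second
row `j = μ.sortedParts.getD 1 0`, `f^μ = C(n, j) (n - 2j + 1) / (n - j + 1)` (in `ℝ`). -/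
theorem trd_numStandardTableaux_eq {n : ℕ} (μ : Nat.Partition n)
    (hμ : Multiset.card μ.parts ≤ 2) :
    (numStandardTableaux μ : ℝ) =
      (n.choose (μ.sortedParts.getD 1 0) : ℝ) * ((n : ℝ) - 2 * (μ.sortedParts.getD 1 0 : ℕ) + 1) /
        ((n : ℝ) - (μ.sortedParts.getD 1 0 : ℕ) + 1) := by
  have h2j := (trd_sortedParts_eq μ hμ).1
  have key := trd_numStandardTableaux_mul μ hμ
  obtain ⟨j, hj⟩ : ∃ j, μ.sortedParts.getD 1 0 = j := ⟨_, rfl⟩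
  rw [hj] at h2j key ⊢
  have hjn : (2 * j : ℝ) ≤ n := by exact_mod_cast h2j
  have hne : (n : ℝ) - j + 1 ≠ 0 := by
    have : (0 : ℝ) ≤ j := Nat.cast_nonneg j
    exact (by linarith : (0 : ℝ) < (n : ℝ) - j + 1).ne'
  rw [eq_div_iff hne]
  have hcast : ((numStandardTableaux μ * (n - j + 1) : ℕ) : ℝ) =
      ((n.choose j * (n - 2 * j + 1) : ℕ) : ℝ) := by rw [key]
  push_cast [Nat.cast_sub (by omega : j ≤ n), Nat.cast_sub h2j] at hcast
  linarith [hcast]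

/-! ## The stub -/

/-- STUB B1 `stub_twoRowDegrees` of the line `schur-weyl-colour-cells` (two-row degrees): the
partitions of `n` with at most two parts are `(n)` and `(n - j, j)`, `1 ≤ j ≤ n/2` (and the empty
partition for `n = 0`), injectively indexed by the second row `j`, and
`f^{(n - j, j)} = C(n,j) (n - 2j + 1) / (n - j + 1)` (Frobenius–Young / Frame–Robinson–Thrall (2.2)
with two rows, `trd_numStandardTableaux_eq`); hence for every real `s` the two-row degree power
sum is at most the ballot power sum over `j ≤ n/2` (the unused terms are `≥ 0`). -/
theorem stub_twoRowDegrees : ∀ (n : ℕ) (s : ℝ), (∑ μ : Nat.Partition n, if Multiset.card μ.parts ≤ 2 then (Literature.NumberTheory.DiophantineGeometry.numStandardTableaux μ : ℝ) ^ s else 0) ≤ ∑ j ∈ Finset.range (n / 2 + 1), ((n.choose j : ℝ) * ((n : ℝ) - 2 * j + 1) / ((n : ℝ) - j + 1)) ^ s := by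
  intro n s
  have hmem : ∀ μ ∈ (Finset.univ.filter fun μ : Nat.Partition n => Multiset.card μ.parts ≤ 2),
      Multiset.card μ.parts ≤ 2 := fun μ hμ => (Finset.mem_filter.1 hμ).2
  calc (∑ μ : Nat.Partition n, if Multiset.card μ.parts ≤ 2 then
          (numStandardTableaux μ : ℝ) ^ s else 0)
      = ∑ μ ∈ (Finset.univ.filter fun μ : Nat.Partition n => Multiset.card μ.parts ≤ 2),
          (numStandardTableaux μ : ℝ) ^ s :=
        (Finset.sum_filter (fun μ : Nat.Partition n => Multiset.card μ.parts ≤ 2)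
          (fun μ => (numStandardTableaux μ : ℝ) ^ s)).symm
    _ = ∑ μ ∈ (Finset.univ.filter fun μ : Nat.Partition n => Multiset.card μ.parts ≤ 2),
          ((n.choose (μ.sortedParts.getD 1 0) : ℝ) *
              ((n : ℝ) - 2 * (μ.sortedParts.getD 1 0 : ℕ) + 1) /
            ((n : ℝ) - (μ.sortedParts.getD 1 0 : ℕ) + 1)) ^ s :=
        Finset.sum_congr rfl fun μ hμ => by rw [trd_numStandardTableaux_eq μ (hmem μ hμ)]
    _ = ∑ j ∈ (Finset.univ.filter fun μ : Nat.Partition n => Multiset.card μ.parts ≤ 2).image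
          (fun μ : Nat.Partition n => μ.sortedParts.getD 1 0),
          ((n.choose j : ℝ) * ((n : ℝ) - 2 * j + 1) / ((n : ℝ) - j + 1)) ^ s :=
        (Finset.sum_image (f := fun j : ℕ =>
          ((n.choose j : ℝ) * ((n : ℝ) - 2 * j + 1) / ((n : ℝ) - j + 1)) ^ s) (trd_injOn n)).symm
    _ ≤ ∑ j ∈ Finset.range (n / 2 + 1),
          ((n.choose j : ℝ) * ((n : ℝ) - 2 * j + 1) / ((n : ℝ) - j + 1)) ^ s := by
        apply Finset.sum_le_sum_of_subset_of_nonneg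
        · intro j hj
          rw [Finset.mem_image] at hj
          obtain ⟨μ, hμ, rfl⟩ := hj
          rw [Finset.mem_range]
          have := (trd_sortedParts_eq μ (hmem μ hμ)).1
          omega
        · intro j hj _
          rw [Finset.mem_range] at hj
          have h2j : 2 * (j : ℝ) ≤ n := by exact_mod_cast (show 2 * j ≤ n by omega)
          have hj0 : (0 : ℝ) ≤ j := Nat.cast_nonneg j
          exact Real.rpow_nonneg
            (div_nonneg (mul_nonneg (Nat.cast_nonneg _) (by linarith)) (by linarith)) s

end Summit.MatrixMultiplication.MatrixMultiplication.Theorems.GradedDesignFamily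

end
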